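import Summits.CriticalPhenomena.PercolationContinuityZ3.Theorems.Transplant.K4MinorFreeDefs
import HarnessLib

/-!
# `K₄`-minor-free graphs are partial 2-trees — file 2: longest paths, Pósa rotation, `K₄` minors from path segments

Support file (`--supports stmt-CriticalPhenomena-4575`), FK sub-lane `prim-bschramm-fk-3` (gen 6) of the post-continuity
programme; builds on p205010 (kernel theorem, internal audit signed; external expert review pending).  Pure graph theory, no
named facts, no sorries; standard axioms.  PURPOSE: the discharge of the named fact `Wagner2008_rc_edgeNegCorr_of_noK4Minor`
(Wagner 2008, graph case; `Literature/Probability/LatticeModels/RandomClusterRayleighSeriesParallel.lean`) needs the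
classical STRUCTURE THEOREM "a finite graph without a `K₄` minor is a subgraph of a 2-tree" (Dirac 1952 / Duffin 1965 /
Wald–Colbourn 1983; Diestel, Graph Theory, §7.3), so that fk-1's kernel theorem `FK.rc_edgeNegCorr_of_isTwoTree` (negative edge correlation of
`φ_{w,q}`, `0 < q ≤ 1`, on 2-tree supports) applies to every `K₄`-minor-free support.

This file (proofs only): a longest path exists (`exists_isLongest`); every neighbour of its first vertex lies on it
(`IsLongest.exists_eq_of_adj`); rotating at a chord gives a longest path (`IsLongest.rot`); segments of a path are connected,
disjoint branch sets (`IsPathSeq.seg_connected`, `…seg_disjoint`); four branch sets give `HasK4Minor` (`hasK4Minor_of_sets`); and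
the two configurations used by the rotation descent: CROSSING CHORDS `f 0 ~ f i`, `f (i-1) ~ f k`, `f 0 ~ f j` with
`i < k ≤ j` (`IsPathSeq.hasK4Minor_A1`) and the LONG JUMP `k > j` (`IsPathSeq.hasK4Minor_A2`).
[cite: Diestel2017, §7.3 (Prop. 7.3.1, Cor. 7.3.2); §1.7]
-/

namespace Summit.CriticalPhenomena.PercolationContinuityZ3.Theorems

namespace K4Free

open Literature.Probability.LatticeModels (HasK4Minor)

variable {V : Type*} {G : SimpleGraph V}

/-! ### Path sequences: length bound, longest paths, the endpoint lemma -/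

/-- A path sequence of length `m` has `m + 1` distinct vertices, so `m < |V|`. [folklore] -/
theorem IsPathSeq.lt_card [Fintype V] {f : ℕ → V} {m : ℕ} (h : IsPathSeq G f m) : m < Fintype.card V := by
  have hinj : Function.Injective (fun t : Fin (m + 1) => f t) := by
    intro s t hst
    exact Fin.ext (h.inj s t (Nat.lt_succ_iff.1 s.2) (Nat.lt_succ_iff.1 t.2) hst)
  have := Fintype.card_le_of_injective _ hinj
  simp only [Fintype.card_fin] at this
  omega

/-- A single vertex is a path sequence of length `0`. [folklore] -/
theorem isPathSeq_zero (v : V) : IsPathSeq G (fun _ => v) 0 :=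
  ⟨fun _ ht => (Nat.not_lt_zero _ ht).elim, fun s t hs ht _ => by omega⟩

/-- An edge is a path sequence of length `1`. [folklore] -/
theorem isPathSeq_one {v w : V} (h : G.Adj v w) : IsPathSeq G (fun t => if t = 0 then v else w) 1 := by
  refine ⟨fun t ht => ?_, fun s t hs ht hst => ?_⟩
  · have ht0 : t = 0 := by omega
    subst ht0; simpa using h
  · by_contra hne
    have hvw : v ≠ w := h.ne
    rcases Nat.eq_zero_or_pos s with hs0 | hs0 <;> rcases Nat.eq_zero_or_pos t with ht0 | ht0
    · omega
    · simp only [hs0, if_true, show t ≠ 0 by omega, if_false] at hst; exact hvw hst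
    · simp only [ht0, if_true, show s ≠ 0 by omega, if_false] at hst; exact hvw hst.symm
    · omega

/-- **A longest path exists** in a finite graph with a vertex. [folklore] -/
theorem exists_isLongest [Fintype V] (v : V) : ∃ (f : ℕ → V) (m : ℕ), IsLongest G f m := by
  classical
  have hP0 : ∃ f : ℕ → V, IsPathSeq G f 0 := ⟨fun _ => v, isPathSeq_zero v⟩
  obtain ⟨f, hf⟩ := Nat.findGreatest_spec (P := fun k => ∃ f : ℕ → V, IsPathSeq G f k) (Nat.zero_le (Fintype.card V)) hP0
  refine ⟨f, _, hf, fun f' m' hf' => ?_⟩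
  exact Nat.le_findGreatest (hf'.lt_card).le ⟨f', hf'⟩

/-- A longest path has length `≥ 1` as soon as the graph has an edge. [folklore] -/
theorem IsLongest.one_le {f : ℕ → V} {m : ℕ} (h : IsLongest G f m) {v w : V} (hvw : G.Adj v w) : 1 ≤ m :=
  h.2 _ 1 (isPathSeq_one hvw)

/-- **Endpoint lemma**: every neighbour of the first vertex of a longest path lies on the path (otherwise the path
could be prolonged). [folklore] -/
theorem IsLongest.exists_eq_of_adj {f : ℕ → V} {m : ℕ} (h : IsLongest G f m) {y : V} (hy : G.Adj (f 0) y) :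
    ∃ t, 1 ≤ t ∧ t ≤ m ∧ f t = y := by
  by_contra hne
  have hne' : ∀ t, t ≤ m → f t ≠ y := by
    intro t ht hft
    rcases Nat.eq_zero_or_pos t with rfl | ht1
    · exact hy.ne hft
    · exact hne ⟨t, ht1, ht, hft⟩
  let f' : ℕ → V := fun t => if t = 0 then y else f (t - 1)
  have hf' : IsPathSeq G f' (m + 1) := by
    refine ⟨fun t ht => ?_, fun s t hs ht hst => ?_⟩
    · rcases Nat.eq_zero_or_pos t with rfl | ht1
      · simpa [f'] using hy.symm
      · simp only [f', show t ≠ 0 by omega, if_false, show t + 1 ≠ 0 by omega]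
        have := h.1.adj (t - 1) (by omega)
        rwa [show t - 1 + 1 = t + 1 - 1 by omega] at this
    · rcases Nat.eq_zero_or_pos s with rfl | hs1 <;> rcases Nat.eq_zero_or_pos t with rfl | ht1
      · rfl
      · simp only [f', if_true, show t ≠ 0 by omega, if_false] at hst
        exact (hne' (t - 1) (by omega) hst.symm).elim
      · simp only [f', if_true, show s ≠ 0 by omega, if_false] at hst
        exact (hne' (s - 1) (by omega) hst).elim
      · simp only [f', show s ≠ 0 by omega, show t ≠ 0 by omega, if_false] at hst
        have := h.1.inj (s - 1) (t - 1) (by omega) (by omega) hst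
        omega
  have := h.2 f' (m + 1) hf'
  omega

/-! ### Rotation -/

/-- **Pósa rotation**: if `f 0 ~ f i` (`2 ≤ i ≤ m`) then `rot f i` is again a path sequence of length `m`. [folklore] -/
theorem IsPathSeq.rot {f : ℕ → V} {m : ℕ} (h : IsPathSeq G f m) {i : ℕ} (hi2 : 2 ≤ i) (him : i ≤ m)
    (hadj : G.Adj (f 0) (f i)) : IsPathSeq G (rot f i) m := by
  refine ⟨fun t ht => ?_, fun s t hs ht hst => ?_⟩
  · by_cases h1 : t + 1 < i
    · rw [rot_of_lt (by omega), rot_of_lt h1]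
      have := h.adj (i - 1 - (t + 1)) (by omega)
      rw [show i - 1 - (t + 1) + 1 = i - 1 - t by omega] at this
      exact this.symm
    · by_cases h2 : t < i
      · have ht : t = i - 1 := by omega
        rw [rot_of_lt h2, rot_of_le (by omega), ht, show i - 1 - (i - 1) = 0 by omega,
          show i - 1 + 1 = i by omega]
        exact hadj
      · rw [rot_of_le (by omega), rot_of_le (by omega)]
        exact h.adj t ht
  · by_cases hs' : s < i <;> by_cases ht' : t < i
    · rw [rot_of_lt hs', rot_of_lt ht'] at hst
      have := h.inj _ _ (by omega) (by omega) hst; omega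
    · rw [rot_of_lt hs', rot_of_le (by omega)] at hst
      have := h.inj _ _ (by omega) (by omega) hst; omega
    · rw [rot_of_le (by omega), rot_of_lt ht'] at hst
      have := h.inj _ _ (by omega) (by omega) hst; omega
    · rw [rot_of_le (by omega), rot_of_le (by omega)] at hst
      exact h.inj _ _ hs ht hst

/-- The rotation of a longest path is a longest path. [folklore] -/
theorem IsLongest.rot {f : ℕ → V} {m : ℕ} (h : IsLongest G f m) {i : ℕ} (hi2 : 2 ≤ i) (him : i ≤ m)
    (hadj : G.Adj (f 0) (f i)) : IsLongest G (rot f i) m :=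
  ⟨h.1.rot hi2 him hadj, h.2⟩

/-! ### Segments of a path as branch sets -/

/-- A segment with `lo ≤ hi` is nonempty. [folklore] -/
theorem seg_nonempty (f : ℕ → V) {lo hi : ℕ} (h : lo ≤ hi) : (seg f lo hi).Nonempty :=
  ⟨f lo, mem_seg le_rfl h⟩

/-- A segment of a path sequence induces a connected subgraph. [folklore] -/
theorem IsPathSeq.seg_connected {f : ℕ → V} {m : ℕ} (h : IsPathSeq G f m) {lo hi : ℕ} (hlh : lo ≤ hi)
    (hhi : hi ≤ m) : (G.induce (seg f lo hi)).Connected := by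
  rw [SimpleGraph.connected_iff_exists_forall_reachable]
  refine ⟨⟨f lo, mem_seg le_rfl hlh⟩, ?_⟩
  have key : ∀ d (hd : lo + d ≤ hi),
      (G.induce (seg f lo hi)).Reachable ⟨f lo, mem_seg le_rfl hlh⟩ ⟨f (lo + d), mem_seg (by omega) hd⟩ := by
    intro d
    induction d with
    | zero => intro hd; exact SimpleGraph.Reachable.refl _
    | succ d ih =>
      intro hd
      refine (ih (by omega)).trans (SimpleGraph.Adj.reachable ?_)
      rw [SimpleGraph.induce_adj]
      exact h.adj (lo + d) (by omega)
  rintro ⟨x, hx⟩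
  obtain ⟨t, h1, h2, rfl⟩ := mem_seg_iff.1 hx
  obtain ⟨d, rfl⟩ : ∃ d, t = lo + d := ⟨t - lo, by omega⟩
  exact key d h2

/-- Segments with separated index ranges are disjoint. [folklore] -/
theorem IsPathSeq.seg_disjoint {f : ℕ → V} {m : ℕ} (h : IsPathSeq G f m) {lo₁ hi₁ lo₂ hi₂ : ℕ}
    (hsep : hi₁ < lo₂) (h2 : hi₂ ≤ m) : Disjoint (seg f lo₁ hi₁) (seg f lo₂ hi₂) := by
  refine Set.disjoint_left.2 fun x hx hx' => ?_
  obtain ⟨s, hs1, hs2, rfl⟩ := mem_seg_iff.1 hx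
  obtain ⟨t, ht1, ht2, hft⟩ := mem_seg_iff.1 hx'
  have := h.inj s t (by omega) (by omega) hft.symm
  omega

/-- Two segments are joined by an edge as soon as some `f s ~ f t` with indices in the two ranges. [folklore] -/
theorem seg_adj (f : ℕ → V) {lo₁ hi₁ lo₂ hi₂ s t : ℕ} (hs1 : lo₁ ≤ s) (hs2 : s ≤ hi₁) (ht1 : lo₂ ≤ t)
    (ht2 : t ≤ hi₂) (hadj : G.Adj (f s) (f t)) : ∃ a ∈ seg f lo₁ hi₁, ∃ b ∈ seg f lo₂ hi₂, G.Adj a b :=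
  ⟨f s, mem_seg hs1 hs2, f t, mem_seg ht1 ht2, hadj⟩

/-- **Four branch sets give a `K₄` minor**: nonempty, connected, pairwise disjoint, pairwise joined. [folklore] -/
theorem hasK4Minor_of_sets (B₀ B₁ B₂ B₃ : Set V) (n0 : B₀.Nonempty) (n1 : B₁.Nonempty) (n2 : B₂.Nonempty)
    (n3 : B₃.Nonempty) (c0 : (G.induce B₀).Connected) (c1 : (G.induce B₁).Connected)
    (c2 : (G.induce B₂).Connected) (c3 : (G.induce B₃).Connected)
    (d01 : Disjoint B₀ B₁) (d02 : Disjoint B₀ B₂) (d03 : Disjoint B₀ B₃) (d12 : Disjoint B₁ B₂)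
    (d13 : Disjoint B₁ B₃) (d23 : Disjoint B₂ B₃)
    (a01 : ∃ a ∈ B₀, ∃ b ∈ B₁, G.Adj a b) (a02 : ∃ a ∈ B₀, ∃ b ∈ B₂, G.Adj a b)
    (a03 : ∃ a ∈ B₀, ∃ b ∈ B₃, G.Adj a b) (a12 : ∃ a ∈ B₁, ∃ b ∈ B₂, G.Adj a b)
    (a13 : ∃ a ∈ B₁, ∃ b ∈ B₃, G.Adj a b) (a23 : ∃ a ∈ B₂, ∃ b ∈ B₃, G.Adj a b) : HasK4Minor G := by
  have sy : ∀ {A B : Set V}, (∃ a ∈ A, ∃ b ∈ B, G.Adj a b) → ∃ a ∈ B, ∃ b ∈ A, G.Adj a b :=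
    fun ⟨a, ha, b, hb, hab⟩ => ⟨b, hb, a, ha, hab.symm⟩
  let B : Fin 4 → Set V := fun i => if i = 0 then B₀ else if i = 1 then B₁ else if i = 2 then B₂ else B₃
  have hB0 : B 0 = B₀ := rfl
  have hB1 : B 1 = B₁ := rfl
  have hB2 : B 2 = B₂ := rfl
  have hB3 : B 3 = B₃ := rfl
  refine ⟨B, ?_, ?_, ?_, ?_⟩
  · intro i; fin_cases i
    · exact n0
    · exact n1
    · exact n2
    · exact n3
  · intro i; fin_cases i
    · exact c0
    · exact c1
    · exact c2
    · exact c3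
  · intro i j hij
    fin_cases i <;> fin_cases j
    all_goals first
      | exact absurd rfl hij
      | exact d01 | exact d02 | exact d03 | exact d12 | exact d13 | exact d23
      | exact d01.symm | exact d02.symm | exact d03.symm | exact d12.symm | exact d13.symm | exact d23.symm
  · intro i j hij
    fin_cases i <;> fin_cases j
    all_goals first
      | exact absurd rfl hij
      | exact a01 | exact a02 | exact a03 | exact a12 | exact a13 | exact a23
      | exact sy a01 | exact sy a02 | exact sy a03 | exact sy a12 | exact sy a13 | exact sy a23

/-- **Crossing chords** (construction A1): a path `f 0 … f m` with `f 0 ~ f i`, `f 0 ~ f j`, `f (i-1) ~ f k` and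
`2 ≤ i < k ≤ j ≤ m` contains a `K₄` minor with branch sets `f[0, i-2]`, `{f (i-1)}`, `f[i, k-1]`, `f[k, j]`. [folklore] -/
theorem IsPathSeq.hasK4Minor_A1 {f : ℕ → V} {m : ℕ} (h : IsPathSeq G f m) {i j k : ℕ} (hi : 2 ≤ i)
    (hik : i < k) (hkj : k ≤ j) (hjm : j ≤ m) (h0i : G.Adj (f 0) (f i)) (h0j : G.Adj (f 0) (f j))
    (hik' : G.Adj (f (i - 1)) (f k)) : HasK4Minor G := by
  refine hasK4Minor_of_sets (seg f 0 (i - 2)) (seg f (i - 1) (i - 1)) (seg f i (k - 1)) (seg f k j)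
    (seg_nonempty f (by omega)) (seg_nonempty f le_rfl) (seg_nonempty f (by omega)) (seg_nonempty f hkj)
    (h.seg_connected (by omega) (by omega)) (h.seg_connected le_rfl (by omega))
    (h.seg_connected (by omega) (by omega)) (h.seg_connected hkj hjm)
    (h.seg_disjoint (by omega) (by omega)) (h.seg_disjoint (by omega) (by omega))
    (h.seg_disjoint (by omega) (by omega)) (h.seg_disjoint (by omega) (by omega))
    (h.seg_disjoint (by omega) (by omega)) (h.seg_disjoint (by omega) (by omega))
    ?_ ?_ ?_ ?_ ?_ ?_
  · -- f (i-2) ~ f (i-1)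
    have := h.adj (i - 2) (by omega)
    rw [show i - 2 + 1 = i - 1 by omega] at this
    exact seg_adj f (by omega) le_rfl le_rfl le_rfl this
  · exact seg_adj f le_rfl (by omega) le_rfl (by omega) h0i
  · exact seg_adj f le_rfl (by omega) (by omega) le_rfl h0j
  · -- f (i-1) ~ f i
    have := h.adj (i - 1) (by omega)
    rw [show i - 1 + 1 = i by omega] at this
    exact seg_adj f le_rfl le_rfl le_rfl (by omega) this
  · exact seg_adj f le_rfl le_rfl le_rfl hkj hik'
  · -- f (k-1) ~ f k
    have := h.adj (k - 1) (by omega)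
    rw [show k - 1 + 1 = k by omega] at this
    exact seg_adj f (by omega) le_rfl le_rfl hkj this

/-- **Long jump** (construction A2): a path `f 0 … f m` with `f 0 ~ f i`, `f 0 ~ f j`, `f (i-1) ~ f k` and
`2 ≤ i < j < k ≤ m` contains a `K₄` minor with branch sets `{f 0}`, `f[1, i-1]`, `f[i, j-1]`, `f[j, k]`. [folklore] -/
theorem IsPathSeq.hasK4Minor_A2 {f : ℕ → V} {m : ℕ} (h : IsPathSeq G f m) {i j k : ℕ} (hi : 2 ≤ i)
    (hij : i < j) (hjk : j < k) (hkm : k ≤ m) (h0i : G.Adj (f 0) (f i)) (h0j : G.Adj (f 0) (f j))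
    (hik' : G.Adj (f (i - 1)) (f k)) : HasK4Minor G := by
  refine hasK4Minor_of_sets (seg f 0 0) (seg f 1 (i - 1)) (seg f i (j - 1)) (seg f j k)
    (seg_nonempty f le_rfl) (seg_nonempty f (by omega)) (seg_nonempty f (by omega)) (seg_nonempty f hjk.le)
    (h.seg_connected le_rfl (by omega)) (h.seg_connected (by omega) (by omega))
    (h.seg_connected (by omega) (by omega)) (h.seg_connected hjk.le hkm)
    (h.seg_disjoint (by omega) (by omega)) (h.seg_disjoint (by omega) (by omega))
    (h.seg_disjoint (by omega) (by omega)) (h.seg_disjoint (by omega) (by omega))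
    (h.seg_disjoint (by omega) (by omega)) (h.seg_disjoint (by omega) (by omega))
    ?_ ?_ ?_ ?_ ?_ ?_
  · exact seg_adj f le_rfl le_rfl le_rfl (by omega) (h.adj 0 (by omega))
  · exact seg_adj f le_rfl le_rfl le_rfl (by omega) h0i
  · exact seg_adj f le_rfl le_rfl le_rfl hjk.le h0j
  · have := h.adj (i - 1) (by omega)
    rw [show i - 1 + 1 = i by omega] at this
    exact seg_adj f (by omega) le_rfl le_rfl (by omega) this
  · exact seg_adj f (by omega) le_rfl (by omega) le_rfl hik'
  · have := h.adj (j - 1) (by omega)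
    rw [show j - 1 + 1 = j by omega] at this
    exact seg_adj f (by omega) le_rfl le_rfl hjk.le this

end K4Free

end Summit.CriticalPhenomena.PercolationContinuityZ3.Theorems
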